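import Summits.CriticalPhenomena.PercolationContinuityZ3.Theorems.PercNearOneGluingNoHeavyLowerTailSunflowerUpReader
import HarnessLib
import HarnessLib.Audit

/-!
# `NoHeavyLowerTail` (crux stmt-CriticalPhenomena-4575), abstract sunflower cubic: the EXACT UP-READER (reading of the `(1|4)`-kernel vectors
# `ν_P` of a cube by `Λ_{P0}`, with its junk term over the RIVALS of `P0`)

Support file (seat `prim-l12-p2` gen 24; `--supports stmt-CriticalPhenomena-4575`).  No `sorry`, no new definitions.
Memo: run/shared/lean/prim/prim-l12/prim-l12-p2/FINDING-g24-LOCAL-ASSIGNMENT.md (§2).  Cube `W`; `ν_P(O) = #{R ∈ A : P ⊆ R ⊆ W∖O}`,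
`M(Y,O) = #{R' ∈ B : O ⊆ R' ⊆ Y}` (mod 2), `Λ_{P0} := Σ_{Y ⊆ W∖P0, lab(W∖Y)=4} M(Y,·)`.  Gen 23 (`nu_read_up`): `⟨Λ_{P0}, ν_{P'}⟩ = [P0 ⊆ P']` if `P0`
has no RIVAL (label-1 `T ⊆ W∖P0` with `lab (W∖T) = 4`).  Here, in general (`Sunflower.nu_read_up_exact`):
`⟨Λ_{P0}, ν_{P'}⟩ = [P0 ⊆ P'] + Σ_{T ⊆ W, lab T = 1} #{R1 ∈ A : P0 ⊆ R1 ⊆ W∖T} · #{R ∈ A : P' ∪ T ⊆ R ⊆ W}` (mod 2) — only rivals `T` contribute,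
and mod 2 the factors are the face numbers `|C₁ ∩ [P0, W∖T]|`, `|C₁ ∩ [P'∪T, W]|`.  Proof: gen 23's exchanges of summation, keeping the label-1 part
of `#{R' ∈ B : R' ⊆ R∖R1} = [R ⊆ R1] − #label-1 − #label-2/3/4` and regrouping it over `T`.  Census (gen 24, `code/junk.c`): identity checked on
770 pairs; the junk vanishes for 684 of them (rival-free: 439) — the basis of the junk-free slot theorem of `…SunflowerLocalAssignmentExact`.
-/

namespace Summit.CriticalPhenomena.PercolationContinuityZ3.Theorems.SunflowerPartition

open Finset

variable {α : Type*} [DecidableEq α]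

namespace Sunflower

variable (F : Sunflower α)

/-- **THE EXACT UP-READER** (this work).  Let `P0, P' ⊆ W` with `lab (W∖P0) = 4` and `lab P' = 1`.  Then
`Σ_{Y ⊆ W∖P0, lab(W∖Y)=4} Σ_O M(Y,O)·ν_{P'}(O) = [P0 ⊆ P'] + Σ_{T ⊆ W, lab T = 1} #{R1 ∈ A : P0 ⊆ R1 ⊆ W∖T}·#{R ∈ A : P' ⊆ R ⊆ W, T ⊆ R}`
(mod 2); the `T`-sum is the JUNK of the reading, supported on the rivals of `P0`. [this work] -/
theorem nu_read_up_exact (W : Finset α) {P0 P' : Finset α} (hP0 : P0 ⊆ W) (hP' : P' ⊆ W)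
    (hcP0 : F.lab (W \ P0) = 4) (hP'1 : F.lab P' = 1) :
    (∑ Y ∈ (W \ P0).powerset, (if F.lab (W \ Y) = 4 then
        ∑ O ∈ W.powerset,
          (∑ R' ∈ W.powerset, (if F.lab R' = 0 ∧ O ⊆ R' ∧ R' ⊆ Y then (1 : ZMod 2) else 0)) *
          (∑ R ∈ W.powerset, (if F.lab R = 4 ∧ P' ⊆ R ∧ R ⊆ W \ O then (1 : ZMod 2) else 0)) else 0))
      = (if P0 ⊆ P' then 1 else 0)
        + ∑ T ∈ W.powerset, (if F.lab T = 1 then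
            (∑ R1 ∈ W.powerset, (if F.lab R1 = 4 ∧ P0 ⊆ R1 ∧ T ⊆ W \ R1 then (1 : ZMod 2) else 0)) *
            (∑ R ∈ W.powerset, (if F.lab R = 4 ∧ P' ⊆ R ∧ T ⊆ R then (1 : ZMod 2) else 0)) else 0) := by
  have hP'4 : F.lab P' ≠ 4 := by rw [hP'1]; decide
  have hO : ∀ Y, ∀ R' ∈ W.powerset, ∀ R ∈ W.powerset,
      (∑ O ∈ W.powerset, ((if F.lab R' = 0 ∧ O ⊆ R' ∧ R' ⊆ Y then (1 : ZMod 2) else 0) * (if F.lab R = 4 ∧ P' ⊆ R ∧ R ⊆ W \ O then (1 : ZMod 2) else 0)))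
        = if F.lab R' = 0 ∧ R' ⊆ Y ∧ F.lab R = 4 ∧ P' ⊆ R ∧ R' ⊆ R then 1 else 0 := by
    intro Y R' hR' R hR
    have hR'W : R' ⊆ W := mem_powerset.1 hR'
    have hRW : R ⊆ W := mem_powerset.1 hR
    by_cases h1 : F.lab R' = 0 ∧ R' ⊆ Y ∧ F.lab R = 4 ∧ P' ⊆ R
    · rw [show (if F.lab R' = 0 ∧ R' ⊆ Y ∧ F.lab R = 4 ∧ P' ⊆ R ∧ R' ⊆ R then (1 : ZMod 2) else 0)
          = if (∅ : Finset α) = R' \ R then 1 else 0 by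
        by_cases h2 : R' ⊆ R
        · rw [if_pos ⟨h1.1, h1.2.1, h1.2.2.1, h1.2.2.2, h2⟩, if_pos (Finset.sdiff_eq_empty_iff_subset.2 h2).symm]
        · rw [if_neg fun h => h2 h.2.2.2.2, if_neg fun h => h2 (Finset.sdiff_eq_empty_iff_subset.1 h.symm)]]
      rw [← HallGladkov.sum_powerset_ite_Icc (A := ∅) (B := R' \ R) (W := W) (sdiff_subset.trans hR'W)]
      refine sum_congr rfl fun O hO => ?_
      simp only [ite_zero_mul_ite_zero, one_mul]
      by_cases h3 : O ⊆ R' \ R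
      · rw [if_pos (show (∅ : Finset α) ⊆ O ∧ O ⊆ R' \ R from ⟨empty_subset _, h3⟩),
          if_pos (show (F.lab R' = 0 ∧ O ⊆ R' ∧ R' ⊆ Y) ∧ F.lab R = 4 ∧ P' ⊆ R ∧ R ⊆ W \ O from ⟨⟨h1.1, h3.trans sdiff_subset, h1.2.1⟩, h1.2.2.1, h1.2.2.2,
              fun x hx => mem_sdiff.2 ⟨hRW hx, fun hxO => (mem_sdiff.1 (h3 hxO)).2 hx⟩⟩)]
      · rw [if_neg (show ¬ ((∅ : Finset α) ⊆ O ∧ O ⊆ R' \ R) from fun h => h3 h.2),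
          if_neg (show ¬ ((F.lab R' = 0 ∧ O ⊆ R' ∧ R' ⊆ Y) ∧ F.lab R = 4 ∧ P' ⊆ R ∧ R ⊆ W \ O) from
            fun h => h3 fun x hx => mem_sdiff.2 ⟨h.1.2.1 hx, fun hxR => (mem_sdiff.1 (h.2.2.2 hxR)).2 hx⟩)]
    · rw [if_neg fun h => h1 ⟨h.1, h.2.1, h.2.2.1, h.2.2.2.1⟩]
      refine sum_eq_zero fun O _ => ?_
      rw [ite_zero_mul_ite_zero, if_neg]
      rintro ⟨⟨h0, -, hY'⟩, h4, hs, -⟩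
      exact h1 ⟨h0, hY', h4, hs⟩
  have stepA : ∀ Y, (∑ O ∈ W.powerset,
        (∑ R' ∈ W.powerset, (if F.lab R' = 0 ∧ O ⊆ R' ∧ R' ⊆ Y then (1 : ZMod 2) else 0)) *
        (∑ R ∈ W.powerset, (if F.lab R = 4 ∧ P' ⊆ R ∧ R ⊆ W \ O then (1 : ZMod 2) else 0)))
      = ∑ R' ∈ W.powerset, ∑ R ∈ W.powerset, (if F.lab R' = 0 ∧ R' ⊆ Y ∧ F.lab R = 4 ∧ P' ⊆ R ∧ R' ⊆ R then (1 : ZMod 2) else 0) := by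
    intro Y
    rw [show (∑ O ∈ W.powerset,
        (∑ R' ∈ W.powerset, (if F.lab R' = 0 ∧ O ⊆ R' ∧ R' ⊆ Y then (1 : ZMod 2) else 0)) *
        (∑ R ∈ W.powerset, (if F.lab R = 4 ∧ P' ⊆ R ∧ R ⊆ W \ O then (1 : ZMod 2) else 0)))
      = ∑ O ∈ W.powerset, ∑ R' ∈ W.powerset, ∑ R ∈ W.powerset, ((if F.lab R' = 0 ∧ O ⊆ R' ∧ R' ⊆ Y then (1 : ZMod 2) else 0) *
           (if F.lab R = 4 ∧ P' ⊆ R ∧ R ⊆ W \ O then (1 : ZMod 2) else 0)) from sum_congr rfl fun O _ => Finset.sum_mul_sum _ _ _ _]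
    rw [Finset.sum_comm]
    refine sum_congr rfl fun R' hR' => ?_
    rw [Finset.sum_comm]
    exact sum_congr rfl fun R hR => hO Y R' hR' R hR
  rw [show (∑ Y ∈ (W \ P0).powerset, (if F.lab (W \ Y) = 4 then
        ∑ O ∈ W.powerset,
          (∑ R' ∈ W.powerset, (if F.lab R' = 0 ∧ O ⊆ R' ∧ R' ⊆ Y then (1 : ZMod 2) else 0)) *
          (∑ R ∈ W.powerset, (if F.lab R = 4 ∧ P' ⊆ R ∧ R ⊆ W \ O then (1 : ZMod 2) else 0)) else 0))
      = ∑ Y ∈ (W \ P0).powerset, ∑ R' ∈ W.powerset, ∑ R ∈ W.powerset, (if F.lab (W \ Y) = 4 ∧ F.lab R' = 0 ∧ R' ⊆ Y ∧ F.lab R = 4 ∧ P' ⊆ R ∧ R' ⊆ R then (1 : ZMod 2) else 0) from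
    sum_congr rfl fun Y _ => by
      by_cases hY : F.lab (W \ Y) = 4
      · rw [if_pos hY, stepA Y]
        exact sum_congr rfl fun R' _ => sum_congr rfl fun R _ => by simp only [hY, true_and]
      · rw [if_neg hY]; symm
        exact sum_eq_zero fun R' _ => sum_eq_zero fun R _ => if_neg fun h => hY h.1]
  rw [Finset.sum_comm]
  have stepB : ∀ R' ∈ W.powerset, ∀ R ∈ W.powerset,
      (∑ Y ∈ (W \ P0).powerset,
        (if F.lab (W \ Y) = 4 ∧ F.lab R' = 0 ∧ R' ⊆ Y ∧ F.lab R = 4 ∧ P' ⊆ R ∧ R' ⊆ R then (1 : ZMod 2) else 0))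
        = (if F.lab R' = 0 ∧ F.lab R = 4 ∧ P' ⊆ R ∧ R' ⊆ R then (1 : ZMod 2) else 0) * ∑ R1 ∈ W.powerset, (if F.lab R1 = 4 ∧ P0 ⊆ R1 ∧ R1 ⊆ W \ R' then (1 : ZMod 2) else 0) := by
    intro R' hR' R hR
    have hR'W : R' ⊆ W := mem_powerset.1 hR'
    by_cases hc : F.lab R' = 0 ∧ F.lab R = 4 ∧ P' ⊆ R ∧ R' ⊆ R
    · rw [if_pos hc, one_mul]
      rw [show (∑ Y ∈ (W \ P0).powerset,
            (if F.lab (W \ Y) = 4 ∧ F.lab R' = 0 ∧ R' ⊆ Y ∧ F.lab R = 4 ∧ P' ⊆ R ∧ R' ⊆ R then (1 : ZMod 2) else 0))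
          = ∑ Y ∈ (W \ P0).powerset, (if Y ⊆ W \ P0 ∧ F.lab (W \ Y) = 4 ∧ R' ⊆ Y then (1 : ZMod 2) else 0) from sum_congr rfl fun Y hY => by
          have hYs : Y ⊆ W \ P0 := mem_powerset.1 hY
          by_cases h : F.lab (W \ Y) = 4 ∧ R' ⊆ Y
          · rw [if_pos ⟨h.1, hc.1, h.2, hc.2.1, hc.2.2.1, hc.2.2.2⟩, if_pos ⟨hYs, h.1, h.2⟩]
          · rw [if_neg fun h' => h ⟨h'.1, h'.2.2.1⟩, if_neg fun h' => h ⟨h'.2.1, h'.2.2⟩]]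
      rw [Finset.sum_subset (powerset_mono.2 (sdiff_subset (s := W) (t := P0)))
          (f := fun Y => if Y ⊆ W \ P0 ∧ F.lab (W \ Y) = 4 ∧ R' ⊆ Y then (1 : ZMod 2) else 0)
          (fun Y _ hYn => if_neg fun h => hYn (mem_powerset.2 h.1))]
      rw [← HallGladkov.sum_powerset_compl W (fun R1 => if F.lab R1 = 4 ∧ P0 ⊆ R1 ∧ R1 ⊆ W \ R' then (1 : ZMod 2) else 0)]
      refine sum_congr rfl fun Y hY => ?_
      have hYW : Y ⊆ W := mem_powerset.1 hY
      have e1 : Y ⊆ W \ P0 ↔ P0 ⊆ W \ Y := by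
        constructor
        · intro h x hx; exact mem_sdiff.2 ⟨hP0 hx, fun hxY => (mem_sdiff.1 (h hxY)).2 hx⟩
        · intro h x hxY; exact mem_sdiff.2 ⟨hYW hxY, fun hxP => (mem_sdiff.1 (h hxP)).2 hxY⟩
      have e2 : R' ⊆ Y ↔ W \ Y ⊆ W \ R' := by
        constructor
        · intro h x hx; exact mem_sdiff.2 ⟨(mem_sdiff.1 hx).1, fun hxR => (mem_sdiff.1 hx).2 (h hxR)⟩
        · intro h x hxR; by_contra hxY; exact (mem_sdiff.1 (h (mem_sdiff.2 ⟨hR'W hxR, hxY⟩))).2 hxR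
      by_cases h : Y ⊆ W \ P0 ∧ F.lab (W \ Y) = 4 ∧ R' ⊆ Y
      · rw [if_pos h, if_pos ⟨h.2.1, e1.1 h.1, e2.1 h.2.2⟩]
      · rw [if_neg h, if_neg fun h' => h ⟨e1.2 h'.2.1, h'.1, e2.2 h'.2.2⟩]
    · rw [if_neg hc, zero_mul]
      exact sum_eq_zero fun Y _ => if_neg fun h => hc ⟨h.2.1, h.2.2.2.1, h.2.2.2.2.1, h.2.2.2.2.2⟩
  rw [show (∑ R' ∈ W.powerset, ∑ Y ∈ (W \ P0).powerset, ∑ R ∈ W.powerset, (if F.lab (W \ Y) = 4 ∧ F.lab R' = 0 ∧ R' ⊆ Y ∧ F.lab R = 4 ∧ P' ⊆ R ∧ R' ⊆ R then (1 : ZMod 2) else 0))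
      = ∑ R' ∈ W.powerset, ∑ R ∈ W.powerset, ((if F.lab R' = 0 ∧ F.lab R = 4 ∧ P' ⊆ R ∧ R' ⊆ R then (1 : ZMod 2) else 0) *
            ∑ R1 ∈ W.powerset, (if F.lab R1 = 4 ∧ P0 ⊆ R1 ∧ R1 ⊆ W \ R' then (1 : ZMod 2) else 0)) from
    sum_congr rfl fun R' hR' => by rw [Finset.sum_comm]; exact sum_congr rfl fun R hR => stepB R' hR' R hR]
  rw [show (∑ R' ∈ W.powerset, ∑ R ∈ W.powerset, ((if F.lab R' = 0 ∧ F.lab R = 4 ∧ P' ⊆ R ∧ R' ⊆ R then (1 : ZMod 2) else 0) *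
            ∑ R1 ∈ W.powerset, (if F.lab R1 = 4 ∧ P0 ⊆ R1 ∧ R1 ⊆ W \ R' then (1 : ZMod 2) else 0)))
      = ∑ R' ∈ W.powerset, ∑ R ∈ W.powerset, ∑ R1 ∈ W.powerset, ((if F.lab R1 = 4 ∧ P0 ⊆ R1 then (1 : ZMod 2) else 0) * (if F.lab R = 4 ∧ P' ⊆ R then (1 : ZMod 2) else 0) *
            (if F.lab R' = 0 ∧ R' ⊆ R ∧ R' ⊆ W \ R1 then (1 : ZMod 2) else 0)) from sum_congr rfl fun R' hR' => sum_congr rfl fun R hR => by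
      have hR'W : R' ⊆ W := mem_powerset.1 hR'
      rw [Finset.mul_sum]
      refine sum_congr rfl fun R1 hR1 => ?_
      have hR1W : R1 ⊆ W := mem_powerset.1 hR1
      have hdisj : R1 ⊆ W \ R' ↔ R' ⊆ W \ R1 := by
        constructor
        · intro h x hx; exact mem_sdiff.2 ⟨hR'W hx, fun hx1 => (mem_sdiff.1 (h hx1)).2 hx⟩
        · intro h x hx; exact mem_sdiff.2 ⟨hR1W hx, fun hx' => (mem_sdiff.1 (h hx')).2 hx⟩
      simp only [ite_zero_mul_ite_zero, one_mul]
      by_cases h : F.lab R' = 0 ∧ F.lab R = 4 ∧ P' ⊆ R ∧ R' ⊆ R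
      · by_cases h' : F.lab R1 = 4 ∧ P0 ⊆ R1 ∧ R1 ⊆ W \ R'
        · rw [if_pos ⟨h, h'⟩, if_pos ⟨⟨⟨h'.1, h'.2.1⟩, h.2.1, h.2.2.1⟩, h.1, h.2.2.2, hdisj.1 h'.2.2⟩]
        · rw [if_neg fun hh => h' hh.2, if_neg fun hh => h' ⟨hh.1.1.1, hh.1.1.2, hdisj.2 hh.2.2.2⟩]
      · rw [if_neg fun hh => h hh.1, if_neg fun hh => h ⟨hh.2.1, hh.1.2.1, hh.1.2.2, hh.2.2.1⟩]]
  rw [Finset.sum_comm]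
  rw [show (∑ R ∈ W.powerset, ∑ R' ∈ W.powerset, ∑ R1 ∈ W.powerset, ((if F.lab R1 = 4 ∧ P0 ⊆ R1 then (1 : ZMod 2) else 0) * (if F.lab R = 4 ∧ P' ⊆ R then (1 : ZMod 2) else 0) *
            (if F.lab R' = 0 ∧ R' ⊆ R ∧ R' ⊆ W \ R1 then (1 : ZMod 2) else 0)))
      = ∑ R ∈ W.powerset, ∑ R1 ∈ W.powerset, ((if F.lab R1 = 4 ∧ P0 ⊆ R1 then (1 : ZMod 2) else 0) * (if F.lab R = 4 ∧ P' ⊆ R then (1 : ZMod 2) else 0) *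
            ∑ R' ∈ W.powerset, (if F.lab R' = 0 ∧ R' ⊆ R ∧ R' ⊆ W \ R1 then (1 : ZMod 2) else 0)) from
    sum_congr rfl fun R _ => by rw [Finset.sum_comm]; exact sum_congr rfl fun R1 _ => by rw [Finset.mul_sum]]
  rw [Finset.sum_comm]
  have stepD : ∀ R1 ∈ W.powerset, ∀ R ∈ W.powerset, F.lab R1 = 4 → P0 ⊆ R1 →
      (∑ R' ∈ W.powerset, (if F.lab R' = 0 ∧ R' ⊆ R ∧ R' ⊆ W \ R1 then (1 : ZMod 2) else 0))
        = (if R ⊆ R1 then 1 else 0)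
          + ∑ G ∈ W.powerset, (if (F.lab G = 2 ∨ F.lab G = 3 ∨ F.lab G = 4) ∧ G ⊆ R ∧ G ⊆ W \ R1 then (1 : ZMod 2) else 0)
          + ∑ T ∈ W.powerset, (if F.lab T = 1 ∧ T ⊆ R ∧ T ⊆ W \ R1 then (1 : ZMod 2) else 0) := by
    intro R1 hR1 R hR h14 hP01
    have hRW : R ⊆ W := mem_powerset.1 hR
    have htot : (∑ R' ∈ W.powerset, (if R' ⊆ R ∧ R' ⊆ W \ R1 then (1 : ZMod 2) else 0)) = if R ⊆ R1 then 1 else 0 := by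
      rw [show (∑ R' ∈ W.powerset, (if R' ⊆ R ∧ R' ⊆ W \ R1 then (1 : ZMod 2) else 0))
          = ∑ R' ∈ W.powerset, (if (∅ : Finset α) ⊆ R' ∧ R' ⊆ R ∩ (W \ R1) then (1 : ZMod 2) else 0) from sum_congr rfl fun R' _ => by
          by_cases h : R' ⊆ R ∧ R' ⊆ W \ R1
          · rw [if_pos h, if_pos ⟨empty_subset _, subset_inter h.1 h.2⟩]
          · rw [if_neg h, if_neg fun h' => h ⟨h'.2.trans inter_subset_left, h'.2.trans inter_subset_right⟩]]
      rw [HallGladkov.sum_powerset_ite_Icc (A := ∅) (B := R ∩ (W \ R1)) (W := W) (inter_subset_left.trans hRW)]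
      by_cases h : R ⊆ R1
      · rw [if_pos h, if_pos]
        symm; refine Finset.eq_empty_iff_forall_notMem.2 fun x hx => ?_
        exact (mem_sdiff.1 (mem_inter.1 hx).2).2 (h (mem_inter.1 hx).1)
      · rw [if_neg h, if_neg]
        intro he
        apply h
        intro x hx
        by_contra hx1
        have : x ∈ R ∩ (W \ R1) := mem_inter.2 ⟨hx, mem_sdiff.2 ⟨hRW hx, hx1⟩⟩
        rw [← he] at this
        exact (Finset.notMem_empty x) this
    have hsplit : ∀ R' ∈ W.powerset, (if R' ⊆ R ∧ R' ⊆ W \ R1 then (1 : ZMod 2) else 0)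
        = (if F.lab R' = 0 ∧ R' ⊆ R ∧ R' ⊆ W \ R1 then (1 : ZMod 2) else 0)
          + ((if (F.lab R' = 2 ∨ F.lab R' = 3 ∨ F.lab R' = 4) ∧ R' ⊆ R ∧ R' ⊆ W \ R1 then (1 : ZMod 2) else 0)
          + (if F.lab R' = 1 ∧ R' ⊆ R ∧ R' ⊆ W \ R1 then (1 : ZMod 2) else 0)) := by
      intro R' hR'
      by_cases h : R' ⊆ R ∧ R' ⊆ W \ R1
      · rw [if_pos h]
        by_cases h0 : F.lab R' = 0
        · have hn : ¬ ((F.lab R' = 2 ∨ F.lab R' = 3 ∨ F.lab R' = 4) ∧ R' ⊆ R ∧ R' ⊆ W \ R1) := by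
            rintro ⟨h', -⟩
            rcases h' with e | e | e <;> rw [h0] at e <;> exact absurd e (by decide)
          have hn1 : ¬ (F.lab R' = 1 ∧ R' ⊆ R ∧ R' ⊆ W \ R1) := by
            rintro ⟨h', -⟩; rw [h0] at h'; exact absurd h' (by decide)
          rw [if_pos ⟨h0, h⟩, if_neg hn, if_neg hn1, add_zero, add_zero]
        · by_cases h1 : F.lab R' = 1
          · have hn : ¬ ((F.lab R' = 2 ∨ F.lab R' = 3 ∨ F.lab R' = 4) ∧ R' ⊆ R ∧ R' ⊆ W \ R1) := by
              rintro ⟨h', -⟩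
              rcases h' with e | e | e <;> rw [h1] at e <;> exact absurd e (by decide)
            rw [if_neg (fun h' => h0 h'.1), if_neg hn, if_pos ⟨h1, h⟩, zero_add, zero_add]
          · have h234 : F.lab R' = 2 ∨ F.lab R' = 3 ∨ F.lab R' = 4 := by
              have : ∀ v : Fin 5, v ≠ 0 → v ≠ 1 → v = 2 ∨ v = 3 ∨ v = 4 := by decide
              exact this _ h0 h1
            rw [if_neg (fun h' => h0 h'.1), if_pos ⟨h234, h⟩, if_neg (fun h' => h1 h'.1), zero_add, add_zero]
      · rw [if_neg h, if_neg fun h' => h h'.2, if_neg fun h' => h h'.2, if_neg fun h' => h h'.2, add_zero, add_zero]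
    rw [sum_congr rfl hsplit, sum_add_distrib, sum_add_distrib] at htot
    have key := eq_sub_of_add_eq htot
    rw [key, sub_eq_add_neg, ZMod.neg_eq_self_mod_two, add_assoc]
  rw [show (∑ R1 ∈ W.powerset, ∑ R ∈ W.powerset, ((if F.lab R1 = 4 ∧ P0 ⊆ R1 then (1 : ZMod 2) else 0) * (if F.lab R = 4 ∧ P' ⊆ R then (1 : ZMod 2) else 0) *
            ∑ R' ∈ W.powerset, (if F.lab R' = 0 ∧ R' ⊆ R ∧ R' ⊆ W \ R1 then (1 : ZMod 2) else 0)))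
      = ∑ R1 ∈ W.powerset, ∑ R ∈ W.powerset, ((((if F.lab R1 = 4 ∧ P0 ⊆ R1 then (1 : ZMod 2) else 0) * (if F.lab R = 4 ∧ P' ⊆ R then (1 : ZMod 2) else 0) *
            (if R ⊆ R1 then 1 else 0))
          + ((if F.lab R1 = 4 ∧ P0 ⊆ R1 then (1 : ZMod 2) else 0) * (if F.lab R = 4 ∧ P' ⊆ R then (1 : ZMod 2) else 0) *
            ∑ G ∈ W.powerset, (if (F.lab G = 2 ∨ F.lab G = 3 ∨ F.lab G = 4) ∧ G ⊆ R ∧ G ⊆ W \ R1 then (1 : ZMod 2) else 0)))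
          + ((if F.lab R1 = 4 ∧ P0 ⊆ R1 then (1 : ZMod 2) else 0) * (if F.lab R = 4 ∧ P' ⊆ R then (1 : ZMod 2) else 0) *
            ∑ T ∈ W.powerset, (if F.lab T = 1 ∧ T ⊆ R ∧ T ⊆ W \ R1 then (1 : ZMod 2) else 0))) from sum_congr rfl fun R1 hR1 => sum_congr rfl fun R hR => by
      by_cases h1 : F.lab R1 = 4 ∧ P0 ⊆ R1
      · rw [stepD R1 hR1 R hR h1.1 h1.2, mul_add, mul_add]
      · simp only [h1, if_false, zero_mul, zero_add]]
  rw [show (∑ R1 ∈ W.powerset, ∑ R ∈ W.powerset, ((((if F.lab R1 = 4 ∧ P0 ⊆ R1 then (1 : ZMod 2) else 0) * (if F.lab R = 4 ∧ P' ⊆ R then (1 : ZMod 2) else 0) *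
            (if R ⊆ R1 then 1 else 0))
          + ((if F.lab R1 = 4 ∧ P0 ⊆ R1 then (1 : ZMod 2) else 0) * (if F.lab R = 4 ∧ P' ⊆ R then (1 : ZMod 2) else 0) *
            ∑ G ∈ W.powerset, (if (F.lab G = 2 ∨ F.lab G = 3 ∨ F.lab G = 4) ∧ G ⊆ R ∧ G ⊆ W \ R1 then (1 : ZMod 2) else 0)))
          + ((if F.lab R1 = 4 ∧ P0 ⊆ R1 then (1 : ZMod 2) else 0) * (if F.lab R = 4 ∧ P' ⊆ R then (1 : ZMod 2) else 0) *
            ∑ T ∈ W.powerset, (if F.lab T = 1 ∧ T ⊆ R ∧ T ⊆ W \ R1 then (1 : ZMod 2) else 0))))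
      = ((∑ R1 ∈ W.powerset, ∑ R ∈ W.powerset, ((if F.lab R1 = 4 ∧ P0 ⊆ R1 then (1 : ZMod 2) else 0) * (if F.lab R = 4 ∧ P' ⊆ R then (1 : ZMod 2) else 0) *
            (if R ⊆ R1 then 1 else 0)))
        + ∑ R1 ∈ W.powerset, ∑ R ∈ W.powerset, ((if F.lab R1 = 4 ∧ P0 ⊆ R1 then (1 : ZMod 2) else 0) * (if F.lab R = 4 ∧ P' ⊆ R then (1 : ZMod 2) else 0) *
            ∑ G ∈ W.powerset, (if (F.lab G = 2 ∨ F.lab G = 3 ∨ F.lab G = 4) ∧ G ⊆ R ∧ G ⊆ W \ R1 then (1 : ZMod 2) else 0)))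
        + ∑ R1 ∈ W.powerset, ∑ R ∈ W.powerset, ((if F.lab R1 = 4 ∧ P0 ⊆ R1 then (1 : ZMod 2) else 0) * (if F.lab R = 4 ∧ P' ⊆ R then (1 : ZMod 2) else 0) *
            ∑ T ∈ W.powerset, (if F.lab T = 1 ∧ T ⊆ R ∧ T ⊆ W \ R1 then (1 : ZMod 2) else 0)) by
    rw [← sum_add_distrib, ← sum_add_distrib]
    exact sum_congr rfl fun R1 _ => by rw [← sum_add_distrib, ← sum_add_distrib]]
  have stepE : (∑ R1 ∈ W.powerset, ∑ R ∈ W.powerset,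
      ((if F.lab R1 = 4 ∧ P0 ⊆ R1 then (1 : ZMod 2) else 0) * (if F.lab R = 4 ∧ P' ⊆ R then (1 : ZMod 2) else 0) * (if R ⊆ R1 then 1 else 0))) = if P0 ⊆ P' then 1 else 0 := by
    rw [Finset.sum_comm]
    have hin : ∀ R ∈ W.powerset, F.lab R = 4 →
        (∑ R1 ∈ W.powerset, ((if F.lab R1 = 4 ∧ P0 ⊆ R1 then (1 : ZMod 2) else 0) * (if R ⊆ R1 then (1 : ZMod 2) else 0)))
          = if P0 ∪ R = W then 1 else 0 := by
      intro R hR hR4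
      rw [← HallGladkov.sum_powerset_ite_superset (P0 ∪ R) W]
      refine sum_congr rfl fun R1 _ => ?_
      rw [ite_zero_mul_ite_zero, one_mul]
      by_cases h : P0 ∪ R ⊆ R1
      · have h1 : R ⊆ R1 := subset_union_right.trans h
        rw [if_pos h, if_pos ⟨⟨F.lab_eq_four_of_subset h1 hR4, subset_union_left.trans h⟩, h1⟩]
      · rw [if_neg h, if_neg fun h' => h (union_subset h'.1.2 h'.2)]
    rw [show (∑ R ∈ W.powerset, ∑ R1 ∈ W.powerset, ((if F.lab R1 = 4 ∧ P0 ⊆ R1 then (1 : ZMod 2) else 0) * (if F.lab R = 4 ∧ P' ⊆ R then (1 : ZMod 2) else 0) *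
            (if R ⊆ R1 then 1 else 0)))
        = ∑ R ∈ W.powerset, (if F.lab R = 4 ∧ P' ⊆ R ∧ P0 ∪ R = W then (1 : ZMod 2) else 0) from sum_congr rfl fun R hR => by
        by_cases h : F.lab R = 4 ∧ P' ⊆ R
        · rw [show (∑ R1 ∈ W.powerset, ((if F.lab R1 = 4 ∧ P0 ⊆ R1 then (1 : ZMod 2) else 0) * (if F.lab R = 4 ∧ P' ⊆ R then (1 : ZMod 2) else 0) * (if R ⊆ R1 then 1 else 0)))
            = ∑ R1 ∈ W.powerset, ((if F.lab R1 = 4 ∧ P0 ⊆ R1 then (1 : ZMod 2) else 0) * (if R ⊆ R1 then (1 : ZMod 2) else 0)) from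
            sum_congr rfl fun R1 _ => by rw [if_pos h, mul_one], hin R hR h.1]
          by_cases h' : P0 ∪ R = W
          · rw [if_pos h', if_pos ⟨h.1, h.2, h'⟩]
          · rw [if_neg h', if_neg fun hh => h' hh.2.2]
        · have hz : ∀ R1, ((if F.lab R1 = 4 ∧ P0 ⊆ R1 then (1 : ZMod 2) else 0) * (if F.lab R = 4 ∧ P' ⊆ R then (1 : ZMod 2) else 0) *
              (if R ⊆ R1 then (1 : ZMod 2) else 0)) = 0 := fun R1 => by rw [if_neg h, mul_zero, zero_mul]
          rw [sum_congr rfl (fun R1 _ => hz R1), sum_const_zero]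
          symm
          exact if_neg fun hh => h ⟨hh.1, hh.2.1⟩]
    rw [show (∑ R ∈ W.powerset, (if F.lab R = 4 ∧ P' ⊆ R ∧ P0 ∪ R = W then (1 : ZMod 2) else 0))
        = ∑ R ∈ W.powerset, (if (W \ P0) ∪ P' ⊆ R then (1 : ZMod 2) else 0) from sum_congr rfl fun R hR => by
        have hRW : R ⊆ W := mem_powerset.1 hR
        by_cases h : (W \ P0) ∪ P' ⊆ R
        · have h1 : W \ P0 ⊆ R := subset_union_left.trans h
          rw [if_pos h, if_pos ⟨F.lab_eq_four_of_subset h1 hcP0, subset_union_right.trans h,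
            (HallGladkov.union_eq_iff_sdiff_subset hP0 hRW).2 h1⟩]
        · rw [if_neg h, if_neg]
          rintro ⟨-, hP'R, hU⟩
          exact h (union_subset ((HallGladkov.union_eq_iff_sdiff_subset hP0 hRW).1 hU) hP'R)]
    rw [HallGladkov.sum_powerset_ite_superset]
    by_cases h : P0 ⊆ P'
    · rw [if_pos h, if_pos]
      exact Subset.antisymm (union_subset sdiff_subset hP') fun x hx => by
        by_cases hxP : x ∈ P0
        · exact mem_union_right _ (h hxP)
        · exact mem_union_left _ (mem_sdiff.2 ⟨hx, hxP⟩)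
    · rw [if_neg h, if_neg]
      intro hU
      apply h
      intro x hx
      have : x ∈ (W \ P0) ∪ P' := hU.symm ▸ hP0 hx
      rcases mem_union.1 this with h1 | h1
      · exact absurd hx (mem_sdiff.1 h1).2
      · exact h1
  have stepF : (∑ R1 ∈ W.powerset, ∑ R ∈ W.powerset,
      ((if F.lab R1 = 4 ∧ P0 ⊆ R1 then (1 : ZMod 2) else 0) * (if F.lab R = 4 ∧ P' ⊆ R then (1 : ZMod 2) else 0) *
        ∑ G ∈ W.powerset, (if (F.lab G = 2 ∨ F.lab G = 3 ∨ F.lab G = 4) ∧ G ⊆ R ∧ G ⊆ W \ R1 then (1 : ZMod 2) else 0))) = 0 := by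
    rw [show (∑ R1 ∈ W.powerset, ∑ R ∈ W.powerset,
        ((if F.lab R1 = 4 ∧ P0 ⊆ R1 then (1 : ZMod 2) else 0) * (if F.lab R = 4 ∧ P' ⊆ R then (1 : ZMod 2) else 0) *
          ∑ G ∈ W.powerset, (if (F.lab G = 2 ∨ F.lab G = 3 ∨ F.lab G = 4) ∧ G ⊆ R ∧ G ⊆ W \ R1 then (1 : ZMod 2) else 0)))
        = ∑ G ∈ W.powerset, ∑ R1 ∈ W.powerset, ((if F.lab R1 = 4 ∧ P0 ⊆ R1 ∧ G ⊆ W \ R1 then (1 : ZMod 2) else 0) *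
            ∑ R ∈ W.powerset, (if (F.lab G = 2 ∨ F.lab G = 3 ∨ F.lab G = 4) ∧ F.lab R = 4 ∧ P' ⊆ R ∧ G ⊆ R then (1 : ZMod 2) else 0)) by
      rw [show (∑ R1 ∈ W.powerset, ∑ R ∈ W.powerset, ((if F.lab R1 = 4 ∧ P0 ⊆ R1 then (1 : ZMod 2) else 0) * (if F.lab R = 4 ∧ P' ⊆ R then (1 : ZMod 2) else 0) *
            ∑ G ∈ W.powerset, (if (F.lab G = 2 ∨ F.lab G = 3 ∨ F.lab G = 4) ∧ G ⊆ R ∧ G ⊆ W \ R1 then (1 : ZMod 2) else 0)))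
          = ∑ R1 ∈ W.powerset, ∑ R ∈ W.powerset, ∑ G ∈ W.powerset,
            ((if F.lab R1 = 4 ∧ P0 ⊆ R1 ∧ G ⊆ W \ R1 then (1 : ZMod 2) else 0) *
              (if (F.lab G = 2 ∨ F.lab G = 3 ∨ F.lab G = 4) ∧ F.lab R = 4 ∧ P' ⊆ R ∧ G ⊆ R then (1 : ZMod 2) else 0)) from sum_congr rfl fun R1 _ => sum_congr rfl fun R _ => by
          rw [Finset.mul_sum]
          refine sum_congr rfl fun G _ => ?_
          simp only [ite_zero_mul_ite_zero, one_mul]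
          by_cases h1 : F.lab R1 = 4 ∧ P0 ⊆ R1
          · by_cases h2 : F.lab R = 4 ∧ P' ⊆ R
            · by_cases h3 : (F.lab G = 2 ∨ F.lab G = 3 ∨ F.lab G = 4) ∧ G ⊆ R ∧ G ⊆ W \ R1
              · rw [if_pos ⟨⟨h1, h2⟩, h3⟩, if_pos ⟨⟨h1.1, h1.2, h3.2.2⟩, h3.1, h2.1, h2.2, h3.2.1⟩]
              · rw [if_neg fun h => h3 h.2, if_neg fun h => h3 ⟨h.2.1, h.2.2.2.2, h.1.2.2⟩]
            · rw [if_neg fun h => h2 h.1.2, if_neg fun h => h2 ⟨h.2.2.1, h.2.2.2.1⟩]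
          · rw [if_neg fun h => h1 h.1.1, if_neg fun h => h1 ⟨h.1.1, h.1.2.1⟩]]
      rw [show (∑ R1 ∈ W.powerset, ∑ R ∈ W.powerset, ∑ G ∈ W.powerset,
            ((if F.lab R1 = 4 ∧ P0 ⊆ R1 ∧ G ⊆ W \ R1 then (1 : ZMod 2) else 0) *
              (if (F.lab G = 2 ∨ F.lab G = 3 ∨ F.lab G = 4) ∧ F.lab R = 4 ∧ P' ⊆ R ∧ G ⊆ R then (1 : ZMod 2) else 0)))
          = ∑ R1 ∈ W.powerset, ∑ G ∈ W.powerset, ∑ R ∈ W.powerset, ((if F.lab R1 = 4 ∧ P0 ⊆ R1 ∧ G ⊆ W \ R1 then (1 : ZMod 2) else 0) *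
              (if (F.lab G = 2 ∨ F.lab G = 3 ∨ F.lab G = 4) ∧ F.lab R = 4 ∧ P' ⊆ R ∧ G ⊆ R then (1 : ZMod 2) else 0)) from sum_congr rfl fun R1 _ => Finset.sum_comm]
      rw [Finset.sum_comm]
      exact sum_congr rfl fun G _ => sum_congr rfl fun R1 _ => by rw [Finset.mul_sum]]
    refine sum_eq_zero fun G hG => ?_
    have hGW : G ⊆ W := mem_powerset.1 hG
    by_cases hG234 : F.lab G = 2 ∨ F.lab G = 3 ∨ F.lab G = 4
    · -- the `R`-sum is `[P' ∪ G = W]`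
      have hPG4 : F.lab (P' ∪ G) = 4 := F.lab_union_eq_four_of_one hP'1 hG234
      have hRsum : (∑ R ∈ W.powerset, (if (F.lab G = 2 ∨ F.lab G = 3 ∨ F.lab G = 4) ∧ F.lab R = 4 ∧ P' ⊆ R ∧ G ⊆ R then (1 : ZMod 2) else 0))
          = if P' ∪ G = W then 1 else 0 := by
        rw [← HallGladkov.sum_powerset_ite_superset (P' ∪ G) W]
        refine sum_congr rfl fun R _ => ?_
        by_cases h : P' ∪ G ⊆ R
        · rw [if_pos h, if_pos ⟨hG234, F.lab_eq_four_of_subset h hPG4, subset_union_left.trans h, subset_union_right.trans h⟩]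
        · rw [if_neg h, if_neg fun h' => h (union_subset h'.2.2.1 h'.2.2.2)]
      by_cases hW : P' ∪ G = W
      · -- then `W ∖ G ⊆ P'`, and no kernel set sits inside `P'`
        rw [show (∑ R1 ∈ W.powerset, ((if F.lab R1 = 4 ∧ P0 ⊆ R1 ∧ G ⊆ W \ R1 then (1 : ZMod 2) else 0) *
              ∑ R ∈ W.powerset, (if (F.lab G = 2 ∨ F.lab G = 3 ∨ F.lab G = 4) ∧ F.lab R = 4 ∧ P' ⊆ R ∧ G ⊆ R then (1 : ZMod 2) else 0)))
            = 0 from sum_eq_zero fun R1 hR1 => by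
              rw [if_neg, zero_mul]
              rintro ⟨h4, -, hG1⟩
              have hR1P : R1 ⊆ P' := by
                intro x hx
                have hxW : x ∈ P' ∪ G := hW.symm ▸ (mem_powerset.1 hR1 hx)
                rcases mem_union.1 hxW with h | h
                · exact h
                · exact absurd hx (mem_sdiff.1 (hG1 h)).2
              exact hP'4 (F.lab_eq_four_of_subset hR1P h4)]
      · rw [hRsum, if_neg hW]
        exact sum_eq_zero fun R1 _ => by rw [mul_zero]
    · rw [show (∑ R ∈ W.powerset, (if (F.lab G = 2 ∨ F.lab G = 3 ∨ F.lab G = 4) ∧ F.lab R = 4 ∧ P' ⊆ R ∧ G ⊆ R then (1 : ZMod 2) else 0)) = 0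
          from sum_eq_zero fun R _ => if_neg fun h => hG234 h.1]
      exact sum_eq_zero fun R1 _ => by rw [mul_zero]
  have stepJ : (∑ R1 ∈ W.powerset, ∑ R ∈ W.powerset,
      ((if F.lab R1 = 4 ∧ P0 ⊆ R1 then (1 : ZMod 2) else 0) * (if F.lab R = 4 ∧ P' ⊆ R then (1 : ZMod 2) else 0) *
        ∑ T ∈ W.powerset, (if F.lab T = 1 ∧ T ⊆ R ∧ T ⊆ W \ R1 then (1 : ZMod 2) else 0)))
      = ∑ T ∈ W.powerset, (if F.lab T = 1 then
          (∑ R1 ∈ W.powerset, (if F.lab R1 = 4 ∧ P0 ⊆ R1 ∧ T ⊆ W \ R1 then (1 : ZMod 2) else 0)) *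
          (∑ R ∈ W.powerset, (if F.lab R = 4 ∧ P' ⊆ R ∧ T ⊆ R then (1 : ZMod 2) else 0)) else 0) := by
    rw [show (∑ R1 ∈ W.powerset, ∑ R ∈ W.powerset,
        ((if F.lab R1 = 4 ∧ P0 ⊆ R1 then (1 : ZMod 2) else 0) * (if F.lab R = 4 ∧ P' ⊆ R then (1 : ZMod 2) else 0) *
          ∑ T ∈ W.powerset, (if F.lab T = 1 ∧ T ⊆ R ∧ T ⊆ W \ R1 then (1 : ZMod 2) else 0)))
        = ∑ R1 ∈ W.powerset, ∑ R ∈ W.powerset, ∑ T ∈ W.powerset,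
          ((if F.lab R1 = 4 ∧ P0 ⊆ R1 ∧ T ⊆ W \ R1 then (1 : ZMod 2) else 0) * (if F.lab T = 1 ∧ F.lab R = 4 ∧ P' ⊆ R ∧ T ⊆ R then (1 : ZMod 2) else 0)) from
      sum_congr rfl fun R1 _ => sum_congr rfl fun R _ => by
        rw [Finset.mul_sum]
        refine sum_congr rfl fun T _ => ?_
        simp only [ite_zero_mul_ite_zero, one_mul]
        by_cases h1 : F.lab R1 = 4 ∧ P0 ⊆ R1
        · by_cases h2 : F.lab R = 4 ∧ P' ⊆ R
          · by_cases h3 : F.lab T = 1 ∧ T ⊆ R ∧ T ⊆ W \ R1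
            · rw [if_pos ⟨⟨h1, h2⟩, h3⟩, if_pos ⟨⟨h1.1, h1.2, h3.2.2⟩, h3.1, h2.1, h2.2, h3.2.1⟩]
            · rw [if_neg fun h => h3 h.2, if_neg fun h => h3 ⟨h.2.1, h.2.2.2.2, h.1.2.2⟩]
          · rw [if_neg fun h => h2 h.1.2, if_neg fun h => h2 ⟨h.2.2.1, h.2.2.2.1⟩]
        · rw [if_neg fun h => h1 h.1.1, if_neg fun h => h1 ⟨h.1.1, h.1.2.1⟩]]
    rw [show (∑ R1 ∈ W.powerset, ∑ R ∈ W.powerset, ∑ T ∈ W.powerset,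
          ((if F.lab R1 = 4 ∧ P0 ⊆ R1 ∧ T ⊆ W \ R1 then (1 : ZMod 2) else 0) * (if F.lab T = 1 ∧ F.lab R = 4 ∧ P' ⊆ R ∧ T ⊆ R then (1 : ZMod 2) else 0)))
        = ∑ R1 ∈ W.powerset, ∑ T ∈ W.powerset, ∑ R ∈ W.powerset, ((if F.lab R1 = 4 ∧ P0 ⊆ R1 ∧ T ⊆ W \ R1 then (1 : ZMod 2) else 0) *
            (if F.lab T = 1 ∧ F.lab R = 4 ∧ P' ⊆ R ∧ T ⊆ R then (1 : ZMod 2) else 0)) from sum_congr rfl fun R1 _ => Finset.sum_comm]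
    rw [Finset.sum_comm]
    refine sum_congr rfl fun T _ => ?_
    rw [show (∑ R1 ∈ W.powerset, ∑ R ∈ W.powerset, ((if F.lab R1 = 4 ∧ P0 ⊆ R1 ∧ T ⊆ W \ R1 then (1 : ZMod 2) else 0) *
            (if F.lab T = 1 ∧ F.lab R = 4 ∧ P' ⊆ R ∧ T ⊆ R then (1 : ZMod 2) else 0)))
        = (∑ R1 ∈ W.powerset, (if F.lab R1 = 4 ∧ P0 ⊆ R1 ∧ T ⊆ W \ R1 then (1 : ZMod 2) else 0)) *
          ∑ R ∈ W.powerset, (if F.lab T = 1 ∧ F.lab R = 4 ∧ P' ⊆ R ∧ T ⊆ R then (1 : ZMod 2) else 0) from by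
      rw [Finset.sum_mul]; exact sum_congr rfl fun R1 _ => by rw [Finset.mul_sum]]
    by_cases hT1 : F.lab T = 1
    · rw [if_pos hT1]
      congr 1
      exact sum_congr rfl fun R _ => by simp only [hT1, true_and]
    · rw [if_neg hT1]
      rw [show (∑ R ∈ W.powerset, (if F.lab T = 1 ∧ F.lab R = 4 ∧ P' ⊆ R ∧ T ⊆ R then (1 : ZMod 2) else 0)) = 0 from sum_eq_zero fun R _ => if_neg fun h => hT1 h.1, mul_zero]
  rw [stepE, stepF, stepJ, add_zero]
end Sunflower

end Summit.CriticalPhenomena.PercolationContinuityZ3.Theorems.SunflowerPartition
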